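import Literature.MathematicalPhysics.PowerSystems.NonMinimumEquilibriumInstability
import HarnessLib

/-!
# Structure-preserving (Bergen–Hill) model: a synchronous state at which the potential energy is
# NOT a local minimum is an UNSTABLE synchronous solution (energy route); on a radial network every
# synchronous state with a negative-cosine line is unstable («2ᴺ⁻¹ − 1 are unstable»,
# Manik–Timme–Witthaut 2017 Cor. 2, for the motions of the structure-preserving model)

Topic `Literature/MathematicalPhysics/PowerSystems`, namespace
`Literature.MathematicalPhysics.PowerSystems.BergenHill` (lit-2's record of the structure-preserving
model `StructurePreservingModel.lean`: data `BergenHill n` = `M, D, P0, b`, nodal flows `flow`,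
solutions `IsSolutionAt`, equilibria `IsEquilibrium`, `syncFrequency` = `ω₀`, `shiftedInjection` = `P̄`,
`shifted`, `isSolutionAt_shifted_iff`; the global-behaviour theorems of
`StructurePreservingDichotomy.lean`; the census lemmas of `FiniteEquilibriumSetIsolation.lean`; the
radial statics of `AcyclicSynchronizationCondition.lean` / `UnicyclicNetworkEquilibria.lean`; the
network-reduced twin `NonMinimumEquilibriumInstability.lean` — all used unchanged). Everything below
is PROVED (no definition, no named fact, no new axiom). This is the structure-preserving twin of
`NonMinimumEquilibriumInstability.lean` (same equilibria, different motions: `Mᵢ ≥ 0` with `Mᵢ = 0`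
exactly at the load buses, whose rows are first-order).

SOURCES (read on the page this session): D. Manik, M. Timme, D. Witthaut, Chaos 27 (2017) 083123
[ManikTimmeWitthaut2017] (arXiv:1611.09825, chunks p0004, p0010–p0011): §2 potential `V(θ)` and
Hesse matrix `M(θ*)` («The fixed points correspond to the local extrema of this potential»; Lemma 1
holds «for both Kuramoto system and the power grid model system»), **Lemma 1** («If one of the
μ_k < 0, then the dynamical system is linearly unstable»), **Cor. 2** (tree: «one is stable and
2^{N−1} − 1 are unstable») with its proof (test vector on one side of a negative-cosine edge,
`vᵀMv = K^red_{ℓ,ℓ+1} < 0`). H.-D. Chiang, IMA 64 (1995) [Chiang1995] (panama:460265875308562 chunks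
p0048, p0071, p0083): **Thm 3.1** (global behaviour; tree: `StructurePreservingDichotomy`), Thm 6.7
(R1), §9 (Bergen–Hill as the first network-preserving model). K. R. Padiyar, *Structure Preserving
Energy Functions in Power Systems* (2013) [Padiyar2013] §3.2 eqs. (3.2)–(3.5), (3.11)–(3.15) through
the model record.

## What is proved (forward solutions `(δ, v)` of (3.2): `∀ t ≥ 0, S.IsSolutionAt δ v t`)

The ENERGY ROUTE of the twin file, read on the structure-preserving rows: the topological energy
`𝓔(δ, v) = Σᵢ(½Mᵢvᵢ² − P⁰ᵢδᵢ) − ½ΣᵢΣⱼ bᵢⱼ cos(δᵢ − δⱼ)` does not increase (generator damping AND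
load frequency dependence dissipate), confined motions are quasi-static and converge (Chiang's
Thm 3.1, `StructurePreservingDichotomy`), and cluster points keep the conserved momentum
`Σᵢ(Mᵢvᵢ + Dᵢδᵢ)`. Hence, in the synchronous frame (`Σ P̄ᵢ = 0`): if the potential
`U(δ) = −Σ P̄ᵢδᵢ − ½ΣΣ bᵢⱼ cos(δᵢ − δⱼ)` is NOT a local minimum at a synchronous state `θe` that is
isolated on its level of `Σ Dᵢδᵢ`, then releasing the network from nearby bus angles `θ₁` on the same
level with `U(θ₁) < U(θe)` and the rotors at synchronous speed gives motions that leave a fixed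
neighbourhood of the synchronous solution — it is UNSTABLE.

* §1 `totalEnergy_eq_potential_of_genRest` (rotors at rest ⇒ `𝓔 = U`, whatever the load-bus
  frequencies, since `Mᵢ = 0` there); `potential_sub_const` (`U(δ − a𝟙) = U(δ) + aΣP⁰ᵢ`);
  **`not_isLocalMin_potential_of_hessForm_neg`** — at an equilibrium, a direction `v` with
  `½ΣΣ bᵢⱼ cos(θᵢ − θⱼ)(vᵢ − vⱼ)² < 0` makes `θ` not a local minimum of `U` (the source's test;
  transported from the twin file through the network-reduced reading of the same data).
* §2 **`exists_escape_of_not_isLocalMin_level`** (`Σ P⁰ᵢ = 0`, `Mᵢ ≥ 0`, `Dᵢ > 0`, `b` symmetric):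
  level isolation near `θe` + `¬ IsLocalMin U θe` ⇒ for every `ε < ρ`, `r > 0` there is `θ₁` on the
  level, `dist(θ₁, θe) < r`, `U(θ₁) < U(θe)`, such that EVERY forward solution with `δ(0) = θ₁` and
  rotor speeds `vᵢ(0) = 0` at the generator nodes reaches `dist((δ(t), v(t)), (θe, 0)) > ε`;
  **`exists_escape_syncFrame_of_not_isLocalMin`** (frame of the data: rotors released at `ω₀`,
  the synchronous-frame orbit `(δ(t) − ω₀t𝟙, v(t) − ω₀𝟙)` leaves the `ε`-ball around `(θe, 0)`).
* §3 RADIAL NETWORKS: **`unstable_syncState_of_neg_branch_of_tree`** /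
  **`unstable_syncSolution_of_neg_branch_of_tree`** — `b` symmetric supported on the lines of a
  rooted tree with positive line coefficients, `Mᵢ ≥ 0`, `Dᵢ > 0`: EVERY synchronous state
  (`Σⱼ bᵢⱼ sin(θeᵢ − θeⱼ) = P̄ᵢ`) with a negative-cosine line is an unstable synchronous solution of
  the structure-preserving model (`∃ ε > 0 ∀ r > 0 ∃ θ₁` on the leaf with `dist(θ₁, θe) < r`: every
  forward solution from bus angles `θ₁` with the rotors at `ω₀` gets farther than `ε` from
  `(θe + ω₀t𝟙, ω₀𝟙)`), hypothesis-free on a tree (`RadialNetwork.finite_pinned_equilibria`,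
  `RadialNetwork.exists_potential_lt_of_neg_branch`). With `RadialNetwork.ncard_pinned_equilibria_eq`
  (exactly `2ⁿ⁻¹` synchronous states per period, one per branch pattern) this is «2^{N−1} − 1 are
  unstable» for the motions of the structure-preserving model.
* §4 (append) THE COUNT, LITERALLY: **`unstable_syncSolution_of_ne_cohesive_of_tree`** (every pinned
  synchronous state of the period box other than the phase-cohesive one is an unstable synchronous
  solution), **`ncard_unstable_syncStates_of_tree`** (strictly feasible tree flows: those states
  number exactly `2ⁿ⁻¹ − 1`, every one unstable; «one is stable» is not asserted).
* §5 (append) «ONE IS STABLE», STATICALLY: **`isLocalMin_potential_of_cohesive`** (an equilibrium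
  with `bᵢⱼcos(θᵢ − θⱼ) > 0` on every line is a local minimum of `U` — transported from
  `ClassicalModel.LosslessSystem.isLocalMin_potential_of_cohesive`, convexity along segments) and
  **`isLocalMin_syncPotential_of_cohesive_of_tree`** (radial: the phase-cohesive synchronous state
  is a local minimum of the synchronous-frame potential `Ũ`). The Lyapunov stability of that
  synchronous solution is NOT asserted here (spectral route: `StructurePreservingSyncExponentialStability`).

DEVIATIONS FROM THE PRINTED PROOF: as in the twin file — the source concludes «linearly unstable»
from a negative eigenvalue of the Hesse matrix (for the second-order oscillator model and the
Kuramoto model); here nonlinear (Lyapunov) instability of the synchronous solution OF THE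
STRUCTURE-PRESERVING MODEL is proved from «not a local minimum + isolation» by the energy argument,
using neither the Jacobian spectrum nor nondegeneracy; the negative-Hessian-direction test is kept
as a sufficient condition (§1). Of the stable clause («one is stable») only the static half is
here (§5: the cohesive state is a local minimum of the potential).

THREE COLUMNS (LADDER-GRIDFUSION honest framing). CERTIFIED for MODEL `M` = structure-preserving
classical model (3.2): lossless lines, `|Vᵢ| = 1`, frequency-dependent loads `Dᵢ > 0`, classical
machines `Mᵢ > 0` with damping, no reactive-power / voltage dynamics (MODEL-VALIDITY MV-3), in its
synchronous frame / on the momentum leaf; CLASS `C` = initial data (bus angles `θ₁` on the leaf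
arbitrarily close to `θe`, rotors at synchronous speed; the load-bus frequencies are forced by the
load rows). «Unstable» refers to the synchronous solution of MODEL `M`, never to a grid. NOT
CLAIMED: where the escaping motions go; anything for continua of equilibria (meshed networks need a
census for the isolation hypothesis, `FiniteEquilibriumSetIsolation`); anything about voltages,
lossy lines, or a grid.
-/

noncomputable section

open Real Set Filter Topology Metric Finset

namespace Literature.MathematicalPhysics.PowerSystems

namespace BergenHill

variable {n : ℕ} (S : BergenHill n)

/-! ### §1. The energy at rotor rest, rotations of the potential, the negative-Hessian test -/

/-- **Rotors at rest ⇒ the energy is the potential**: if `vᵢ = 0` at every generator node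
(`Mᵢ ≠ 0`), then `𝓔(δ, v) = Σᵢ(½Mᵢvᵢ² − P⁰ᵢδᵢ) − ½ΣΣ bᵢⱼcos(δᵢ − δⱼ) = −Σ P⁰ᵢδᵢ − ½ΣΣ bᵢⱼcos(δᵢ − δⱼ)`
whatever the load-bus frequencies (their kinetic coefficient `Mᵢ` is zero).
[cite: Padiyar2013, §3.2 eqs. (3.11), (3.14) (kinetic energy of the rotors only)] -/
theorem totalEnergy_eq_potential_of_genRest (δ v : Fin n → ℝ) (hv : ∀ i, S.M i ≠ 0 → v i = 0) :
    (∑ i, (S.M i / 2 * v i ^ 2 - S.P0 i * δ i)) - 1 / 2 * ∑ i, ∑ j, S.b i j * Real.cos (δ i - δ j)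
      = -∑ i, S.P0 i * δ i - 1 / 2 * ∑ i, ∑ j, S.b i j * Real.cos (δ i - δ j) := by
  have h : ∀ i, S.M i / 2 * v i ^ 2 = 0 := fun i => by
    by_cases hi : S.M i = 0
    · rw [hi]; ring
    · rw [hv i hi]; ring
  simp only [h, zero_sub, Finset.sum_neg_distrib]

/-- A uniform shift of all bus angles changes the potential by the work of the injections:
`U(δ − a𝟙) = U(δ) + aΣᵢP⁰ᵢ` (rotation-invariant when `Σ P⁰ᵢ = 0`, the synchronous frame).
[cite: ManikTimmeWitthaut2017, §2 («any fixed point θ* is arbitrary up to an additive constant c»); Padiyar2013, §3.2 text after (3.5) («Σ P̄ᵢ = 0»)] -/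
theorem potential_sub_const (δ : Fin n → ℝ) (a : ℝ) :
    -∑ i, S.P0 i * (δ i - a) - 1 / 2 * ∑ i, ∑ j, S.b i j * Real.cos (δ i - a - (δ j - a))
      = (-∑ i, S.P0 i * δ i - 1 / 2 * ∑ i, ∑ j, S.b i j * Real.cos (δ i - δ j))
        + a * ∑ i, S.P0 i := by
  simp only [sub_sub_sub_cancel_right]
  have h : ∑ i, S.P0 i * (δ i - a) = ∑ i, S.P0 i * δ i - a * ∑ i, S.P0 i := by
    rw [Finset.mul_sum, ← Finset.sum_sub_distrib]
    exact Finset.sum_congr rfl fun i _ => by ring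
  rw [h]
  ring

/-- **A negative Hessian direction at an equilibrium ⇒ the potential is NOT a local minimum**
(`b` symmetric): `Σⱼ bᵢⱼ sin(θᵢ − θⱼ) = P⁰ᵢ` at every bus and `½ΣᵢΣⱼ bᵢⱼ cos(θᵢ − θⱼ)(vᵢ − vⱼ)² < 0`
for some direction `v` ⇒ `θ` is not a local minimum of `U(δ) = −Σ P⁰ᵢδᵢ − ½ΣΣ bᵢⱼcos(δᵢ − δⱼ)`
(the potential is the network-reduced one of the same data with no infinite bus:
`ClassicalModel.LosslessSystem.not_isLocalMin_potential_of_hessForm_neg`).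
[cite: ManikTimmeWitthaut2017, §3 Lemma 1 and §5.2 proof of Cor. 2 («vᵀMv = K^red_{ℓ,ℓ+1} < 0 … the fixed point is unstable»)] -/
theorem not_isLocalMin_potential_of_hessForm_neg (hb : ∀ i j, S.b i j = S.b j i)
    {θ : Fin n → ℝ} (hθ : S.IsEquilibrium θ) (v : Fin n → ℝ)
    (hv : 1 / 2 * ∑ i, ∑ j, S.b i j * Real.cos (θ i - θ j) * (v i - v j) ^ 2 < 0) :
    ¬ IsLocalMin (fun δ : Fin n → ℝ =>
      -∑ i, S.P0 i * δ i - 1 / 2 * ∑ i, ∑ j, S.b i j * Real.cos (δ i - δ j)) θ := by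
  set L : ClassicalModel.LosslessSystem n 0 :=
    { M := S.M, D := S.D, P := S.P0, C := S.b, K := fun _ b => b.elim0, β := fun b => b.elim0 }
    with hL
  have hLU : L.potential = fun δ : Fin n → ℝ =>
      -∑ i, S.P0 i * δ i - 1 / 2 * ∑ i, ∑ j, S.b i j * Real.cos (δ i - δ j) :=
    funext fun δ => L.potential_eq_of_noBus δ
  have hθL : L.IsEquilibrium θ := fun i => by
    show S.P0 i = L.flow θ i
    have : L.flow θ i = S.flow θ i := by
      simp [ClassicalModel.LosslessSystem.flow, flow, hL]
    rw [this, hθ i]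
  have h := L.not_isLocalMin_potential_of_hessForm_neg hb hθL v (by simpa [hL] using hv)
  rwa [hLU] at h

/-! ### §2. Instability within the momentum leaf (synchronous frame) and in the frame of the data -/

/-- From «not a local minimum» to smaller values arbitrarily close (private). [folklore]
[cite: ManikTimmeWitthaut2017, §3 Lemma 1] -/
private theorem exists_lt_of_not_isLocalMin {f : (Fin n → ℝ) → ℝ} {θe : Fin n → ℝ}
    (hmin : ¬ IsLocalMin f θe) {r : ℝ} (hr : 0 < r) :
    ∃ θ₁ : Fin n → ℝ, dist θ₁ θe < r ∧ f θ₁ < f θe := by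
  have h1 : ∃ᶠ θ in 𝓝 θe, ¬ (f θe ≤ f θ) := by
    unfold IsLocalMin IsMinFilter at hmin
    exact Filter.not_eventually.1 hmin
  obtain ⟨θ₁, hθ₁, hlt⟩ := (Metric.nhds_basis_ball.frequently_iff.1 h1) r hr
  exact ⟨θ₁, mem_ball.1 hθ₁, not_le.1 hlt⟩

/-- Along a forward solution with `Σ P⁰ᵢ = 0` every cluster point lies on the momentum leaf of the
initial data (private). [folklore] [cite: Padiyar2013, §3.2 eq. (3.15) and Remark 1] -/
private theorem momentum_eq_of_mapClusterPt (hb : ∀ i j, S.b i j = S.b j i)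
    (hP : ∑ i, S.P0 i = 0) {δ v : ℝ → Fin n → ℝ} (hsol : ∀ t, 0 ≤ t → S.IsSolutionAt δ v t)
    {x : (Fin n → ℝ) × (Fin n → ℝ)} (hx : MapClusterPt x atTop fun t => (δ t, v t)) :
    ∑ i, (S.M i * x.2 i + S.D i * x.1 i) = ∑ i, (S.M i * v 0 i + S.D i * δ 0 i) := by
  set ℓ := ∑ i, (S.M i * v 0 i + S.D i * δ 0 i) with hℓ
  set g : (Fin n → ℝ) × (Fin n → ℝ) → ℝ := fun y => ∑ i, (S.M i * y.2 i + S.D i * y.1 i) with hg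
  have hlevel : ∀ t, 0 ≤ t → g (δ t, v t) = ℓ := by
    intro t ht
    simp only [hg]
    rw [S.sum_momentum_eq hb hsol ht, hP, zero_mul, add_zero]
  have hgc : Continuous g := by simp only [hg]; fun_prop
  have h1 : MapClusterPt (g x) atTop (g ∘ fun t => (δ t, v t)) :=
    hx.continuousAt_comp hgc.continuousAt
  have hconst : Tendsto (g ∘ fun t => (δ t, v t)) atTop (𝓝 ℓ) := by
    refine tendsto_const_nhds.congr' ?_
    filter_upwards [eventually_ge_atTop 0] with t ht
    simp only [Function.comp_apply]
    exact (hlevel t ht).symm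
  have h2 : ClusterPt (g x) (𝓝 ℓ) := h1.clusterPt.mono hconst
  exact t2_iff_nhds.1 inferInstance h2

/-- Core of the energy route (private): a forward solution whose initial energy is BELOW `U(θe)`
cannot stay in a closed ball around `(θe, 0)` in which `(θe, 0)` is the only possible equilibrium
cluster point. [folklore] [cite: Chiang1995, §3 Thm 3.1] -/
private theorem exists_dist_gt_of_totalEnergy_lt (hb : ∀ i j, S.b i j = S.b j i)
    (hM : ∀ i, 0 ≤ S.M i) (hD : ∀ i, 0 < S.D i) {θe : Fin n → ℝ} {ε : ℝ}
    {δ v : ℝ → Fin n → ℝ} (hsol : ∀ t, 0 ≤ t → S.IsSolutionAt δ v t)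
    (hE : (∑ i, (S.M i / 2 * v 0 i ^ 2 - S.P0 i * δ 0 i))
        - 1 / 2 * ∑ i, ∑ j, S.b i j * Real.cos (δ 0 i - δ 0 j)
      < -∑ i, S.P0 i * θe i - 1 / 2 * ∑ i, ∑ j, S.b i j * Real.cos (θe i - θe j))
    (hfix : ∀ x : (Fin n → ℝ) × (Fin n → ℝ), dist x (θe, 0) ≤ ε →
      MapClusterPt x atTop (fun t => (δ t, v t)) → x.2 = 0 → S.IsEquilibrium x.1 → x = (θe, 0)) :
    ∃ t, 0 ≤ t ∧ ε < dist (δ t, v t) ((θe, 0) : (Fin n → ℝ) × (Fin n → ℝ)) := by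
  by_contra hcon
  push Not at hcon
  have hD0 : ∀ i, 0 ≤ S.D i := fun i => (hD i).le
  set E : (Fin n → ℝ) × (Fin n → ℝ) → ℝ := fun x =>
    (∑ i, (S.M i / 2 * x.2 i ^ 2 - S.P0 i * x.1 i))
      - 1 / 2 * ∑ i, ∑ j, S.b i j * Real.cos (x.1 i - x.1 j) with hEdef
  have hEc : Continuous E := S.continuous_totalEnergy
  set K : Set ((Fin n → ℝ) × (Fin n → ℝ)) := closedBall (θe, 0) ε with hKdef
  have hK : IsCompact K := isCompact_closedBall _ _
  have hXK : ∀ t, 0 ≤ t → (δ t, v t) ∈ K := fun t ht => mem_closedBall.2 (hcon t ht)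
  -- the energy is bounded below on `K`: the motion is quasi-static
  obtain ⟨L, hL⟩ := hK.bddBelow_image hEc.continuousOn
  have hL' : ∀ t, 0 ≤ t → L ≤ (∑ i, (S.M i / 2 * v t i ^ 2 - S.P0 i * δ t i))
      - 1 / 2 * ∑ i, ∑ j, S.b i j * Real.cos (δ t i - δ t j) :=
    fun t ht => hL ⟨(δ t, v t), hXK t ht, rfl⟩
  obtain ⟨e, he⟩ := S.exists_tendsto_totalEnergy_of_bddBelow hb hD0 hsol hL'
  have hω := fun i => S.tendsto_speed_zero_of_tendsto_totalEnergy hb hM hD hsol he i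
  have hmis := fun i => S.tendsto_mismatch_zero_of_tendsto_totalEnergy hb hM hD hsol he i
  -- every cluster point in `K` is the rest point `(θe, 0)`
  have hev : ∀ᶠ t in atTop, (δ t, v t) ∈ K := (eventually_ge_atTop 0).mono fun t ht => hXK t ht
  have huniq : ∀ x ∈ K, MapClusterPt x atTop (fun t => (δ t, v t)) → x = (θe, 0) := by
    intro x hxK hx
    obtain ⟨hx2, hx1⟩ := S.isEquilibrium_of_mapClusterPt hω hmis hx
    exact hfix x (mem_closedBall.1 hxK) hx hx2 hx1
  have hlim : Tendsto (fun t => (δ t, v t)) atTop (𝓝 (θe, 0)) :=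
    hK.tendsto_nhds_of_unique_mapClusterPt hev huniq
  -- so the energy tends to `E(θe, 0) = U(θe)` while staying `≤ E(0) < U(θe)`
  have hElim : Tendsto (fun t => E (δ t, v t)) atTop (𝓝 (E (θe, 0))) :=
    (hEc.tendsto _).comp hlim
  have hE0 : E (θe, 0) = -∑ i, S.P0 i * θe i - 1 / 2 * ∑ i, ∑ j, S.b i j * Real.cos (θe i - θe j) := by
    simp only [hEdef, Pi.zero_apply]
    exact S.totalEnergy_eq_potential_of_genRest θe 0 fun i _ => rfl
  have hle : E (θe, 0) ≤ E (δ 0, v 0) :=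
    le_of_tendsto hElim ((eventually_ge_atTop 0).mono fun t ht =>
      S.totalEnergy_le_of_le hb hD0 hsol le_rfl ht)
  have hE' : E (δ 0, v 0) < E (θe, 0) := by rw [hE0]; exact hE
  linarith

/-- **INSTABILITY WITHIN THE MOMENTUM LEAF (structure-preserving model in its synchronous frame:
`Σ P⁰ᵢ = 0`; `Mᵢ ≥ 0`, `Dᵢ > 0`, `b` symmetric).** Let `θe` be a bus-angle vector near which the
equilibria (`Σⱼ bᵢⱼ sin(δᵢ − δⱼ) = P⁰ᵢ`) ON THE LEVEL `Σ Dᵢδᵢ = Σ Dᵢθeᵢ` are isolated (radius `ρ`),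
and at which the potential `U(δ) = −Σ P⁰ᵢδᵢ − ½ΣΣ bᵢⱼcos(δᵢ − δⱼ)` is NOT a local minimum. Then for
every `ε < ρ` and `r > 0` there are bus angles `θ₁` on the same level, `dist(θ₁, θe) < r`,
`U(θ₁) < U(θe)`, such that EVERY forward solution of (3.2) with `δ(0) = θ₁` and the rotors at
rest (`vᵢ(0) = 0` at the generator nodes; it exists and is unique, `exists_solution` /
`solution_unique`) reaches `dist((δ(t), v(t)), (θe, 0)) > ε` at some `t ≥ 0`. Mechanism as in the
network-reduced twin: the energy starts at `U(θ₁) < U(θe)` and never increases; staying in the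
closed `ε`-ball would make the motion quasi-static (Chiang's Thm 3.1) with `(θe, 0)` as its only
cluster point on the conserved leaf, forcing the energy back to `U(θe)`. THREE COLUMNS: CERTIFIED
for MODEL `M` = SPM (MV-3) in the synchronous frame, CLASS `C` = the said initial data arbitrarily
close to `(θe, 0)` on the leaf; NOT CLAIMED: anything off the leaf, anything about a grid.
[cite: ManikTimmeWitthaut2017, §3 Lemma 1 and §5.2 Cor. 2; Chiang1995, §3 Thm 3.1 and §9; Padiyar2013, §3.2 eqs. (3.2)–(3.5), (3.15) Remark 1] -/
theorem exists_escape_of_not_isLocalMin_level (hb : ∀ i j, S.b i j = S.b j i)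
    (hM : ∀ i, 0 ≤ S.M i) (hD : ∀ i, 0 < S.D i) (hP : ∑ i, S.P0 i = 0)
    {θe : Fin n → ℝ} {ρ : ℝ}
    (hiso : ∀ θ, S.IsEquilibrium θ → ∑ i, S.D i * θ i = ∑ i, S.D i * θe i →
      dist θ θe < ρ → θ = θe)
    (hmin : ¬ IsLocalMin (fun δ : Fin n → ℝ =>
      -∑ i, S.P0 i * δ i - 1 / 2 * ∑ i, ∑ j, S.b i j * Real.cos (δ i - δ j)) θe)
    {ε : ℝ} (hερ : ε < ρ) {r : ℝ} (hr : 0 < r) :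
    ∃ θ₁ : Fin n → ℝ, dist θ₁ θe < r ∧ ∑ i, S.D i * θ₁ i = ∑ i, S.D i * θe i ∧
      (-∑ i, S.P0 i * θ₁ i - 1 / 2 * ∑ i, ∑ j, S.b i j * Real.cos (θ₁ i - θ₁ j)
        < -∑ i, S.P0 i * θe i - 1 / 2 * ∑ i, ∑ j, S.b i j * Real.cos (θe i - θe j)) ∧
      ∀ δ v : ℝ → Fin n → ℝ, δ 0 = θ₁ → (∀ i, S.M i ≠ 0 → v 0 i = 0) →
        (∀ t, 0 ≤ t → S.IsSolutionAt δ v t) →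
        ∃ t, 0 ≤ t ∧ ε < dist (δ t, v t) ((θe, 0) : (Fin n → ℝ) × (Fin n → ℝ)) := by
  rcases Nat.eq_zero_or_pos n with hn | hn
  · subst hn
    obtain ⟨θ₀, -, hlt⟩ := exists_lt_of_not_isLocalMin hmin one_pos
    rw [Subsingleton.elim θ₀ θe] at hlt
    exact absurd hlt (lt_irrefl _)
  haveI : Nonempty (Fin n) := ⟨⟨0, hn⟩⟩
  have hDs : 0 < ∑ i, S.D i := Finset.sum_pos (fun i _ => hD i) Finset.univ_nonempty
  -- a nearby bus-angle vector of smaller potential, moved back to the leaf by a rotation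
  obtain ⟨θ'', hθ''d, hθ''U⟩ := exists_lt_of_not_isLocalMin hmin (half_pos hr)
  set a : ℝ := (∑ i, S.D i * (θ'' i - θe i)) / ∑ i, S.D i with ha
  set θ₁ : Fin n → ℝ := fun j => θ'' j - a with hθ₁
  have hlev : ∑ i, S.D i * θ₁ i = ∑ i, S.D i * θe i := by
    have h1 : ∑ i, S.D i * θ₁ i = ∑ i, S.D i * θ'' i - a * ∑ i, S.D i := by
      simp only [hθ₁]
      rw [Finset.mul_sum, ← Finset.sum_sub_distrib]
      exact Finset.sum_congr rfl fun i _ => by ring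
    have h2 : a * ∑ i, S.D i = ∑ i, S.D i * (θ'' i - θe i) := by
      rw [ha, div_mul_cancel₀ _ hDs.ne']
    have h3 : ∑ i, S.D i * (θ'' i - θe i) = ∑ i, S.D i * θ'' i - ∑ i, S.D i * θe i := by
      rw [← Finset.sum_sub_distrib]
      exact Finset.sum_congr rfl fun i _ => by ring
    rw [h1, h2, h3]
    ring
  have hU₁ : -∑ i, S.P0 i * θ₁ i - 1 / 2 * ∑ i, ∑ j, S.b i j * Real.cos (θ₁ i - θ₁ j)
      = -∑ i, S.P0 i * θ'' i - 1 / 2 * ∑ i, ∑ j, S.b i j * Real.cos (θ'' i - θ'' j) := by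
    simp only [hθ₁]
    rw [S.potential_sub_const, hP, mul_zero, add_zero]
  have habs : |a| ≤ dist θ'' θe := by
    rw [ha, abs_div, abs_of_pos hDs, div_le_iff₀ hDs]
    calc |∑ i, S.D i * (θ'' i - θe i)| ≤ ∑ i, |S.D i * (θ'' i - θe i)| :=
          Finset.abs_sum_le_sum_abs _ _
      _ = ∑ i, S.D i * |θ'' i - θe i| :=
          Finset.sum_congr rfl fun i _ => by rw [abs_mul, abs_of_pos (hD i)]
      _ ≤ ∑ i, S.D i * dist θ'' θe :=
          Finset.sum_le_sum fun i _ => mul_le_mul_of_nonneg_left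
            (by rw [← Real.dist_eq]; exact dist_le_pi_dist θ'' θe i) (hD i).le
      _ = dist θ'' θe * ∑ i, S.D i := by rw [mul_comm, Finset.sum_mul]
  have hdist : dist θ₁ θe < r := by
    have h1 : dist θ₁ θe ≤ dist θ'' θe + |a| := by
      refine (dist_pi_le_iff (by positivity)).2 fun j => ?_
      rw [Real.dist_eq]
      calc |θ₁ j - θe j| = |(θ'' j - θe j) - a| := by simp only [hθ₁]; ring_nf
        _ ≤ |θ'' j - θe j| + |a| := abs_sub _ _
        _ ≤ dist θ'' θe + |a| := by
            rw [← Real.dist_eq]; linarith [dist_le_pi_dist θ'' θe j]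
    linarith
  refine ⟨θ₁, hdist, hlev, by rw [hU₁]; exact hθ''U, fun δ v hδ0 hv0 hsol => ?_⟩
  refine S.exists_dist_gt_of_totalEnergy_lt hb hM hD hsol ?_ fun x hxε hx hx2 hx1 => ?_
  · rw [S.totalEnergy_eq_potential_of_genRest (δ 0) (v 0) hv0, hδ0, hU₁]
    exact hθ''U
  · -- the cluster point lies on the leaf of the initial data, which is the leaf of `θe`
    have hmom0 : ∑ i, (S.M i * v 0 i + S.D i * δ 0 i) = ∑ i, S.D i * θe i := by
      rw [← hlev, hδ0]
      refine Finset.sum_congr rfl fun i _ => ?_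
      by_cases hi : S.M i = 0
      · rw [hi]; ring
      · rw [hv0 i hi]; ring
    have hlx : ∑ i, S.D i * x.1 i = ∑ i, S.D i * θe i := by
      have h := S.momentum_eq_of_mapClusterPt hb hP hsol hx
      rw [hx2, hmom0] at h
      simpa only [Pi.zero_apply, mul_zero, zero_add] using h
    have hd1 : dist x.1 θe ≤ ε := by
      rw [Prod.dist_eq] at hxε
      exact (le_max_left _ _).trans hxε
    have h1 : x.1 = θe := hiso x.1 hx1 hlx (lt_of_le_of_lt hd1 hερ)
    exact Prod.ext h1 hx2

/-- **The same in the frame of the data** (`ω₀ = ΣP⁰ᵢ/ΣDᵢ`, `P̄ᵢ = P⁰ᵢ − Dᵢω₀`; `Mᵢ ≥ 0`,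
`Dᵢ > 0`, `b` symmetric). Let `θe` be a SYNCHRONOUS STATE (`Σⱼ bᵢⱼ sin(θeᵢ − θeⱼ) = P̄ᵢ`, the s.e.p.
candidates `α₀` of (3.12) in bus angles), isolated near itself among synchronous states on its level
of `Σ Dᵢδᵢ` (radius `ρ`), at which `Ũ(δ) = −Σ P̄ᵢδᵢ − ½ΣΣ bᵢⱼcos(δᵢ − δⱼ)` is NOT a local minimum. Then
for every `ε < ρ`, `r > 0` there are bus angles `θ₁` on the same level, `dist(θ₁, θe) < r`, such
that EVERY forward solution of (3.2) with `δ(0) = θ₁` and the rotors at synchronous speed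
(`vᵢ(0) = ω₀` at the generator nodes) has its synchronous-frame orbit `(δ(t) − ω₀t𝟙, v(t) − ω₀𝟙)`
(3.4) leave the `ε`-ball around `(θe, 0)` — the distance to the synchronous solution
`(θe + ω₀t𝟙, ω₀𝟙)` exceeds `ε` at some `t ≥ 0` (`isSolutionAt_shifted_iff`, then the leaf form).
[cite: ManikTimmeWitthaut2017, §3 Lemma 1 and §5.2 Cor. 2; Padiyar2013, §3.2 eqs. (3.3)–(3.5), (3.12); Chiang1995, §3 Thm 3.1 and §9] -/
theorem exists_escape_syncFrame_of_not_isLocalMin (hb : ∀ i j, S.b i j = S.b j i)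
    (hM : ∀ i, 0 ≤ S.M i) (hD : ∀ i, 0 < S.D i) {θe : Fin n → ℝ} {ρ : ℝ}
    (hiso : ∀ θ : Fin n → ℝ, (∀ i, S.flow θ i = S.shiftedInjection i) →
      ∑ i, S.D i * θ i = ∑ i, S.D i * θe i → dist θ θe < ρ → θ = θe)
    (hmin : ¬ IsLocalMin (fun δ : Fin n → ℝ =>
      -∑ i, S.shiftedInjection i * δ i - 1 / 2 * ∑ i, ∑ j, S.b i j * Real.cos (δ i - δ j)) θe)
    {ε : ℝ} (hερ : ε < ρ) {r : ℝ} (hr : 0 < r) :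
    ∃ θ₁ : Fin n → ℝ, dist θ₁ θe < r ∧ ∑ i, S.D i * θ₁ i = ∑ i, S.D i * θe i ∧
      ∀ δ v : ℝ → Fin n → ℝ, δ 0 = θ₁ → (∀ i, S.M i ≠ 0 → v 0 i = S.syncFrequency) →
        (∀ t, 0 ≤ t → S.IsSolutionAt δ v t) →
        ∃ t, 0 ≤ t ∧ ε < dist ((fun i => δ t i - S.syncFrequency * t),
          (fun i => v t i - S.syncFrequency)) ((θe, 0) : (Fin n → ℝ) × (Fin n → ℝ)) := by
  have hb' : ∀ i j, S.shifted.b i j = S.shifted.b j i := hb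
  have hM' : ∀ i, 0 ≤ S.shifted.M i := hM
  have hD' : ∀ i, 0 < S.shifted.D i := hD
  have hPs : ∑ i, S.shifted.P0 i = 0 := S.sum_shiftedInjection_eq_zero_of_pos hD
  have hiso' : ∀ θ, S.shifted.IsEquilibrium θ →
      ∑ i, S.shifted.D i * θ i = ∑ i, S.shifted.D i * θe i → dist θ θe < ρ → θ = θe :=
    fun θ hθ hl hd => hiso θ (fun i => hθ i) hl hd
  obtain ⟨θ₁, hd, hlev, -, hesc⟩ :=
    S.shifted.exists_escape_of_not_isLocalMin_level hb' hM' hD' hPs hiso' hmin hερ hr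
  refine ⟨θ₁, hd, hlev, fun δ v hδ0 hv0 hsol => ?_⟩
  set δc : ℝ → Fin n → ℝ := fun s i => δ s i - S.syncFrequency * s with hδc
  set vc : ℝ → Fin n → ℝ := fun s i => v s i - S.syncFrequency with hvc
  have hsol' : ∀ t, 0 ≤ t → S.shifted.IsSolutionAt δc vc t :=
    fun t ht => S.isSolutionAt_shifted_iff.mpr (hsol t ht)
  have hδc0 : δc 0 = θ₁ := by
    funext i; simp [hδc, hδ0]
  have hvc0 : ∀ i, S.shifted.M i ≠ 0 → vc 0 i = 0 := fun i hi => by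
    simp only [hvc, hv0 i hi, sub_self]
  exact hesc δc vc hδc0 hvc0 hsol'

/-! ### §3. RADIAL NETWORKS: every synchronous state with a negative-cosine line is an unstable
synchronous solution of the structure-preserving model (Cor. 2, «unstable» clause) -/

/-- **On a radial network, a synchronous state of the structure-preserving model with a
negative-cosine line is an UNSTABLE synchronous solution** (`Mᵢ ≥ 0`, `Dᵢ > 0`, `b` symmetric,
supported on the lines of a rooted tree with positive line coefficients `b_{i, parent i} > 0`). Let
`θe` solve `Σⱼ bᵢⱼ sin(θeᵢ − θeⱼ) = P̄ᵢ` at every bus with `cos(θeᵢ − θe_{parent i}) < 0` on some line.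
Then `∃ ε > 0 ∀ r > 0 ∃ θ₁` on the level `Σ Dₖθ₁ₖ = Σ Dₖθeₖ` with `dist(θ₁, θe) < r` such that EVERY
forward solution of (3.2) from bus angles `θ₁` with the rotors at `ω₀` has its synchronous-frame
orbit leave the `ε`-ball around `(θe, 0)`. Ingredients: not an energy minimum by the subtree shift
across the negative line (`RadialNetwork.exists_potential_lt_of_neg_branch`, the source's test
vector); finitely many synchronous states per period on a tree
(`RadialNetwork.finite_pinned_equilibria`) ⇒ isolated on every level
(`exists_levelIsolation_of_finite_syncEquilibria`); §2. With `RadialNetwork.ncard_pinned_equilibria_eq`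
(exactly `2ⁿ⁻¹` synchronous states per period, one per branch pattern; only all-`+` has no negative
line) this is the printed «2^{N−1} − 1 are unstable», for the structure-preserving motions. THREE
COLUMNS: CERTIFIED for MODEL `M` = SPM (MV-3) on a RADIAL network, CLASS `C` = the said initial data;
NOT CLAIMED: stability of the all-`+` state (an energy-well statement), anything about a grid.
[cite: ManikTimmeWitthaut2017, §5.2 Cor. 2 and its proof, §3 Lemma 1; DorflerChertkovBullo2013, SI §3.2 Thm 2 (G1); Chiang1995, §3 Thm 3.1 and §9; Padiyar2013, §3.2 eqs. (3.2)–(3.5)] -/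
theorem unstable_syncState_of_neg_branch_of_tree (hb : ∀ i j, S.b i j = S.b j i)
    (hM : ∀ i, 0 ≤ S.M i) (hD : ∀ i, 0 < S.D i)
    {root : Fin n} {parent : Fin n → Fin n} {depth : Fin n → ℕ} (hpr : parent root = root)
    (hdepth : ∀ i, i ≠ root → depth i = depth (parent i) + 1)
    (htree : ∀ i j, i ≠ j → S.b i j ≠ 0 → (i ≠ root ∧ j = parent i) ∨ (j ≠ root ∧ i = parent j))
    (ha : ∀ i, i ≠ root → 0 < S.b i (parent i))
    {θe : Fin n → ℝ} (he : ∀ k, S.flow θe k = S.shiftedInjection k)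
    {i : Fin n} (hi : i ≠ root) (hneg : Real.cos (θe i - θe (parent i)) < 0) :
    ∃ ε > 0, ∀ r > 0, ∃ θ₁ : Fin n → ℝ, dist θ₁ θe < r ∧ ∑ k, S.D k * θ₁ k = ∑ k, S.D k * θe k ∧
      ∀ δ v : ℝ → Fin n → ℝ, δ 0 = θ₁ → (∀ k, S.M k ≠ 0 → v 0 k = S.syncFrequency) →
        (∀ t, 0 ≤ t → S.IsSolutionAt δ v t) →
        ∃ t, 0 ≤ t ∧ ε < dist ((fun k => δ t k - S.syncFrequency * t),
          (fun k => v t k - S.syncFrequency)) ((θe, 0) : (Fin n → ℝ) × (Fin n → ℝ)) := by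
  -- the synchronous states of the tree: a finite pinned census, hence level isolation
  have hfinIco := ClassicalModel.RadialNetwork.finite_pinned_equilibria hdepth S.b hb htree
    (fun k hk => (ha k hk).ne') S.shiftedInjection
  have hfinIcc := ClassicalModel.UnicyclicNetwork.finite_pinned_Icc_of_finite_pinned_Ico S.b
    S.shiftedInjection root hfinIco
  obtain ⟨ρ, hρ, hisoG⟩ := S.exists_levelIsolation_of_finite_syncEquilibria hD root
    (hfinIcc.subset fun θ ⟨h1, h2, h3⟩ => ⟨h1, h2, fun k => h3 k⟩)
  have hiso : ∀ θ : Fin n → ℝ, (∀ k, S.flow θ k = S.shiftedInjection k) →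
      ∑ k, S.D k * θ k = ∑ k, S.D k * θe k → dist θ θe < ρ → θ = θe :=
    fun θ hθ hl hd => hisoG θ θe hθ he hl hd
  -- the synchronous state is not a local minimum of the frame potential (subtree shift)
  have heq : ∀ k, ∑ j, S.b k j * Real.sin (θe k - θe j) = S.shiftedInjection k := he
  have hmin : ¬ IsLocalMin (fun δ : Fin n → ℝ =>
      -∑ k, S.shiftedInjection k * δ k - 1 / 2 * ∑ k, ∑ l, S.b k l * Real.cos (δ k - δ l)) θe := by
    intro hloc
    have hev : ∀ᶠ θ in 𝓝 θe,
        (-∑ k, S.shiftedInjection k * θe k - 1 / 2 * ∑ k, ∑ l, S.b k l * Real.cos (θe k - θe l))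
          ≤ -∑ k, S.shiftedInjection k * θ k - 1 / 2 * ∑ k, ∑ l, S.b k l * Real.cos (θ k - θ l) :=
      hloc
    rw [Metric.eventually_nhds_iff] at hev
    obtain ⟨ε₀, hε₀, hle⟩ := hev
    obtain ⟨θ', hθ'd, hθ'U⟩ := ClassicalModel.RadialNetwork.exists_potential_lt_of_neg_branch hpr hdepth S.b hb
      htree S.shiftedInjection heq hi (ha i hi) hneg hε₀
    exact absurd (hle hθ'd) (not_le.2 hθ'U)
  refine ⟨ρ / 2, by positivity, fun r hr => ?_⟩
  exact S.exists_escape_syncFrame_of_not_isLocalMin hb hM hD hiso hmin (ε := ρ / 2)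
    (by linarith) hr

/-- **Cor. 2, «unstable» clause, read against the synchronous solution itself**: on a radial
network a synchronous state `θe` of the structure-preserving model with a negative-cosine line
gives an UNSTABLE synchronous solution `t ↦ (θe + ω₀t𝟙, ω₀𝟙)` — `∃ ε > 0 ∀ r > 0 ∃ θ₁` on the leaf
with `dist(θ₁, θe) < r` such that every forward solution from bus angles `θ₁` with the rotors at
`ω₀` satisfies `dist((δ(t), v(t)), (θe + ω₀t𝟙, ω₀𝟙)) > ε` at some `t ≥ 0`.
[cite: ManikTimmeWitthaut2017, §5.2 Cor. 2 («one is stable and 2^{N−1} − 1 are unstable») and §3 Lemma 1; Padiyar2013, §3.2 eqs. (3.2)–(3.5); Chiang1995, §3 Thm 3.1 and §9] -/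
theorem unstable_syncSolution_of_neg_branch_of_tree (hb : ∀ i j, S.b i j = S.b j i)
    (hM : ∀ i, 0 ≤ S.M i) (hD : ∀ i, 0 < S.D i)
    {root : Fin n} {parent : Fin n → Fin n} {depth : Fin n → ℕ} (hpr : parent root = root)
    (hdepth : ∀ i, i ≠ root → depth i = depth (parent i) + 1)
    (htree : ∀ i j, i ≠ j → S.b i j ≠ 0 → (i ≠ root ∧ j = parent i) ∨ (j ≠ root ∧ i = parent j))
    (ha : ∀ i, i ≠ root → 0 < S.b i (parent i))
    {θe : Fin n → ℝ} (he : ∀ k, S.flow θe k = S.shiftedInjection k)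
    {i : Fin n} (hi : i ≠ root) (hneg : Real.cos (θe i - θe (parent i)) < 0) :
    ∃ ε > 0, ∀ r > 0, ∃ θ₁ : Fin n → ℝ, dist θ₁ θe < r ∧ ∑ k, S.D k * θ₁ k = ∑ k, S.D k * θe k ∧
      ∀ δ v : ℝ → Fin n → ℝ, δ 0 = θ₁ → (∀ k, S.M k ≠ 0 → v 0 k = S.syncFrequency) →
        (∀ t, 0 ≤ t → S.IsSolutionAt δ v t) →
        ∃ t, 0 ≤ t ∧ ε < dist ((δ t, v t) : (Fin n → ℝ) × (Fin n → ℝ))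
          ((fun k => θe k + S.syncFrequency * t), fun _ => S.syncFrequency) := by
  obtain ⟨ε, hε, h⟩ :=
    S.unstable_syncState_of_neg_branch_of_tree hb hM hD hpr hdepth htree ha he hi hneg
  refine ⟨ε, hε, fun r hr => ?_⟩
  obtain ⟨θ₁, hd, hl, hesc⟩ := h r hr
  refine ⟨θ₁, hd, hl, fun δ v hδ0 hv0 hsol => ?_⟩
  obtain ⟨t, ht, hdist⟩ := hesc δ v hδ0 hv0 hsol
  refine ⟨t, ht, ?_⟩
  have key := ClassicalModel.LosslessSystem.dist_syncFrame_eq (δ t, v t) θe S.syncFrequency t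
  simp only at key
  rwa [key] at hdist

/-! ### §4. (Append) THE COUNT «2ᴺ⁻¹ − 1 ARE UNSTABLE», LITERALLY, for the structure-preserving
motions: every pinned synchronous state of the period box other than the phase-cohesive one is an
unstable synchronous solution; with strictly feasible tree flows they number exactly `2ⁿ⁻¹ − 1` -/

/-- **Every pinned synchronous state other than the phase-cohesive one is an unstable synchronous
solution of the structure-preserving model** (radial network, `Mᵢ ≥ 0`, `Dᵢ > 0`, `b` symmetric
tree-supported with positive line coefficients): if `θc` is a synchronous state of the period box
`[−π, π)ⁿ` pinned at the root with all line cosines `≥ 0`, every OTHER pinned synchronous state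
`θe` of the box gives an unstable synchronous solution `(θe + ω₀t𝟙, ω₀𝟙)` (the branch pattern
determines the state, `ClassicalModel.RadialNetwork.exists_neg_branch_of_ne_cohesive`; then §3).
[cite: ManikTimmeWitthaut2017, §5.2 Cor. 2 and its proof; Padiyar2013, §3.2 eqs. (3.2)–(3.5); Chiang1995, §3 Thm 3.1 and §9] -/
theorem unstable_syncSolution_of_ne_cohesive_of_tree (hb : ∀ i j, S.b i j = S.b j i)
    (hM : ∀ i, 0 ≤ S.M i) (hD : ∀ i, 0 < S.D i)
    {root : Fin n} {parent : Fin n → Fin n} {depth : Fin n → ℕ} (hpr : parent root = root)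
    (hdepth : ∀ i, i ≠ root → depth i = depth (parent i) + 1)
    (htree : ∀ i j, i ≠ j → S.b i j ≠ 0 → (i ≠ root ∧ j = parent i) ∨ (j ≠ root ∧ i = parent j))
    (ha : ∀ i, i ≠ root → 0 < S.b i (parent i))
    {θc : Fin n → ℝ} (hrc : θc root = 0) (hboxc : ∀ i, θc i ∈ Set.Ico (-π) π)
    (hec : ∀ k, S.flow θc k = S.shiftedInjection k)
    (hcoh : ∀ i, i ≠ root → 0 ≤ Real.cos (θc i - θc (parent i)))
    {θe : Fin n → ℝ} (hr : θe root = 0) (hbox : ∀ i, θe i ∈ Set.Ico (-π) π)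
    (he : ∀ k, S.flow θe k = S.shiftedInjection k) (hne : θe ≠ θc) :
    ∃ ε > 0, ∀ r > 0, ∃ θ₁ : Fin n → ℝ, dist θ₁ θe < r ∧ ∑ k, S.D k * θ₁ k = ∑ k, S.D k * θe k ∧
      ∀ δ v : ℝ → Fin n → ℝ, δ 0 = θ₁ → (∀ k, S.M k ≠ 0 → v 0 k = S.syncFrequency) →
        (∀ t, 0 ≤ t → S.IsSolutionAt δ v t) →
        ∃ t, 0 ≤ t ∧ ε < dist ((δ t, v t) : (Fin n → ℝ) × (Fin n → ℝ))
          ((fun k => θe k + S.syncFrequency * t), fun _ => S.syncFrequency) := by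
  obtain ⟨i, hi, hneg⟩ := ClassicalModel.RadialNetwork.exists_neg_branch_of_ne_cohesive hdepth S.b
    hb htree (fun k hk => (ha k hk).ne') S.shiftedInjection hr hbox (fun k => he k) hrc hboxc
    (fun k => hec k) hcoh hne
  exact S.unstable_syncSolution_of_neg_branch_of_tree hb hM hD hpr hdepth htree ha he hi hneg

/-- **«Of the `2ᴺ⁻¹` fixed points … `2ᴺ⁻¹ − 1` are unstable», for the motions of the
structure-preserving model on a radial network with strictly feasible tree flows.** With the tree
flows `u` of the shifted injections (`P̄ = (tree divergence of u)`, `|uᵢ| < b_{i,parent i}`), the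
pinned synchronous states of the period box `[−π, π)ⁿ` number exactly `2ⁿ⁻¹`
(`RadialNetwork.ncard_pinned_equilibria_eq`); if `θc` is the phase-cohesive one, the OTHER
`2ⁿ⁻¹ − 1` states are, every one of them, unstable synchronous solutions (the stability of `θc` —
«one is stable» — is an energy-well statement not proved here).
[cite: ManikTimmeWitthaut2017, §5.2 Cor. 2 («there are 2^{N−1} fixed points … one is stable and 2^{N−1} − 1 are unstable»); DorflerChertkovBullo2013, SI §3.2 Thm 2 (G1); Padiyar2013, §3.2 eqs. (3.2)–(3.5); Chiang1995, §3 Thm 3.1] -/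
theorem ncard_unstable_syncStates_of_tree (hb : ∀ i j, S.b i j = S.b j i)
    (hM : ∀ i, 0 ≤ S.M i) (hD : ∀ i, 0 < S.D i)
    {root : Fin n} {parent : Fin n → Fin n} {depth : Fin n → ℕ} (hpr : parent root = root)
    (hroot : depth root = 0) (hdepth : ∀ i, i ≠ root → depth i = depth (parent i) + 1)
    (htree : ∀ i j, i ≠ j → S.b i j ≠ 0 → (i ≠ root ∧ j = parent i) ∨ (j ≠ root ∧ i = parent j))
    (ha : ∀ i, i ≠ root → 0 < S.b i (parent i)) (u : Fin n → ℝ)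
    (hcons : ∀ i, S.shiftedInjection i = (if i ≠ root then u i else 0)
      - ∑ j ∈ Finset.univ.filter (fun j => j ≠ root ∧ parent j = i), u j)
    (hu : ∀ i, i ≠ root → |u i| < S.b i (parent i))
    {θc : Fin n → ℝ} (hrc : θc root = 0) (hboxc : ∀ i, θc i ∈ Set.Ico (-π) π)
    (hec : ∀ k, S.flow θc k = S.shiftedInjection k)
    (hcoh : ∀ i, i ≠ root → 0 ≤ Real.cos (θc i - θc (parent i))) :
    ({θ : Fin n → ℝ | θ root = 0 ∧ (∀ i, θ i ∈ Set.Ico (-π) π) ∧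
        ∀ k, S.flow θ k = S.shiftedInjection k} \ {θc}).ncard = 2 ^ (n - 1) - 1 ∧
      ∀ θe ∈ {θ : Fin n → ℝ | θ root = 0 ∧ (∀ i, θ i ∈ Set.Ico (-π) π) ∧
          ∀ k, S.flow θ k = S.shiftedInjection k} \ {θc},
        ∃ ε > 0, ∀ r > 0, ∃ θ₁ : Fin n → ℝ, dist θ₁ θe < r ∧
          ∑ k, S.D k * θ₁ k = ∑ k, S.D k * θe k ∧
          ∀ δ v : ℝ → Fin n → ℝ, δ 0 = θ₁ → (∀ k, S.M k ≠ 0 → v 0 k = S.syncFrequency) →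
            (∀ t, 0 ≤ t → S.IsSolutionAt δ v t) →
            ∃ t, 0 ≤ t ∧ ε < dist ((δ t, v t) : (Fin n → ℝ) × (Fin n → ℝ))
              ((fun k => θe k + S.syncFrequency * t), fun _ => S.syncFrequency) := by
  set E : Set (Fin n → ℝ) := {θ : Fin n → ℝ | θ root = 0 ∧ (∀ i, θ i ∈ Set.Ico (-π) π) ∧
    ∀ k, S.flow θ k = S.shiftedInjection k} with hE
  have hfin : E.Finite :=
    (ClassicalModel.RadialNetwork.finite_pinned_equilibria hdepth S.b hb htree
      (fun k hk => (ha k hk).ne') S.shiftedInjection).subset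
      fun θ ⟨h1, h2, h3⟩ => ⟨h1, h2, fun k => h3 k⟩
  have hcard : E.ncard = 2 ^ (n - 1) := by
    have h := ClassicalModel.RadialNetwork.ncard_pinned_equilibria_eq hroot hdepth S.b hb htree ha
      S.shiftedInjection u hcons hu
    have hEeq : E = {θ : Fin n → ℝ | θ root = 0 ∧ (∀ i, θ i ∈ Set.Ico (-π) π) ∧
        ∀ k, ∑ j, S.b k j * Real.sin (θ k - θ j) = S.shiftedInjection k} := by
      ext θ; exact Iff.rfl
    rw [hEeq]
    exact h
  have hmem : θc ∈ E := ⟨hrc, hboxc, hec⟩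
  refine ⟨by rw [Set.ncard_sdiff_singleton_of_mem hmem, hcard], ?_⟩
  rintro θe ⟨⟨hr, hbox, he⟩, hne⟩
  exact S.unstable_syncSolution_of_ne_cohesive_of_tree hb hM hD hpr hdepth htree ha hrc hboxc hec
    hcoh hr hbox he hne

/-! ### §5. (Append) «ONE IS STABLE», STATICALLY: a phase-cohesive synchronous state of the
structure-preserving model is a local minimum of the potential energy (transported from
`ClassicalModel.LosslessSystem.isLocalMin_potential_of_cohesive`; the other `2ᴺ⁻¹ − 1` pinned
synchronous states of a tree are unstable synchronous solutions, §3–§4) -/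

/-- **A phase-cohesive equilibrium is a local minimum of the potential** (`b` symmetric):
`Σⱼ bᵢⱼ sin(θᵢ − θⱼ) = P⁰ᵢ` at every bus and `bᵢⱼ cos(θᵢ − θⱼ) > 0` for every line (`i ≠ j`,
`bᵢⱼ ≠ 0`) ⇒ `U(δ) = −Σ P⁰ᵢδᵢ − ½ΣΣ bᵢⱼcos(δᵢ − δⱼ)` has a local minimum at `θ` (convexity of `U` along
short segments from `θ`; the network-reduced reading of the same data with no infinite bus).
[cite: ManikTimmeWitthaut2017, §3 Lemma 1 (proof: «In normal operation … M is a Laplacian matrix») and §5.2 proof of Cor. 2 («Choosing the +-sign for all edges yields one stable fixed point»); Padiyar2013, §3.2 eqs. (3.11)–(3.15) (the potential energy of the SPM)] -/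
theorem isLocalMin_potential_of_cohesive (hb : ∀ i j, S.b i j = S.b j i)
    {θ : Fin n → ℝ} (hθ : S.IsEquilibrium θ)
    (hcoh : ∀ i j, i ≠ j → S.b i j ≠ 0 → 0 < S.b i j * Real.cos (θ i - θ j)) :
    IsLocalMin (fun δ : Fin n → ℝ =>
      -∑ i, S.P0 i * δ i - 1 / 2 * ∑ i, ∑ j, S.b i j * Real.cos (δ i - δ j)) θ := by
  set L : ClassicalModel.LosslessSystem n 0 :=
    { M := S.M, D := S.D, P := S.P0, C := S.b, K := fun _ b => b.elim0, β := fun b => b.elim0 }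
    with hL
  have hLU : L.potential = fun δ : Fin n → ℝ =>
      -∑ i, S.P0 i * δ i - 1 / 2 * ∑ i, ∑ j, S.b i j * Real.cos (δ i - δ j) :=
    funext fun δ => L.potential_eq_of_noBus δ
  have hθL : L.IsEquilibrium θ := fun i => by
    show S.P0 i = L.flow θ i
    have : L.flow θ i = S.flow θ i := by
      simp [ClassicalModel.LosslessSystem.flow, flow, hL]
    rw [this, hθ i]
  have h := L.isLocalMin_potential_of_cohesive hb hθL (fun i j hij hc => hcoh i j hij hc)
    (fun i b _ => b.elim0)
  rwa [hLU] at h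

/-- **On a radial network the phase-cohesive synchronous state minimises the synchronous-frame
potential locally** (`b` symmetric, tree-supported): if `Σⱼ bᵢⱼ sin(θcᵢ − θcⱼ) = P̄ᵢ` at every bus
and `b_{i,p(i)} cos(θcᵢ − θc_{p(i)}) > 0` on every tree line, then
`Ũ(δ) = −Σ P̄ᵢδᵢ − ½ΣΣ bᵢⱼcos(δᵢ − δⱼ)` has a local minimum at `θc` — the «+»-pattern state of
Cor. 2 is the energy minimum among the `2ᴺ⁻¹` synchronous states per period, every other one being
an unstable synchronous solution (`unstable_syncSolution_of_ne_cohesive_of_tree`). The Lyapunov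
stability of the synchronous solution through `θc` is not asserted here
(cf. `StructurePreservingSyncExponentialStability` for the spectral route).
[cite: ManikTimmeWitthaut2017, §5.2 Cor. 2 and its proof; DorflerChertkovBullo2013, SI §3.2 Thm 2 (G1); Padiyar2013, §3.2 eqs. (3.5), (3.12)] -/
theorem isLocalMin_syncPotential_of_cohesive_of_tree (hb : ∀ i j, S.b i j = S.b j i)
    {root : Fin n} {parent : Fin n → Fin n}
    (htree : ∀ i j, i ≠ j → S.b i j ≠ 0 → (i ≠ root ∧ j = parent i) ∨ (j ≠ root ∧ i = parent j))
    {θc : Fin n → ℝ} (hec : ∀ k, S.flow θc k = S.shiftedInjection k)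
    (hcoh : ∀ i, i ≠ root → 0 < S.b i (parent i) * Real.cos (θc i - θc (parent i))) :
    IsLocalMin (fun δ : Fin n → ℝ =>
      -∑ i, S.shiftedInjection i * δ i - 1 / 2 * ∑ i, ∑ j, S.b i j * Real.cos (δ i - δ j)) θc := by
  have hb' : ∀ i j, S.shifted.b i j = S.shifted.b j i := hb
  have hec' : S.shifted.IsEquilibrium θc := fun k => hec k
  refine S.shifted.isLocalMin_potential_of_cohesive hb' hec' fun i j hij hc => ?_
  have hc' : S.b i j ≠ 0 := hc
  show 0 < S.b i j * Real.cos (θc i - θc j)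
  rcases htree i j hij hc' with ⟨hi, hj⟩ | ⟨hj, hi⟩
  · subst hj
    exact hcoh i hi
  · subst hi
    rw [hb (parent j) j, ← Real.cos_neg, neg_sub]
    exact hcoh j hj

end BergenHill

end Literature.MathematicalPhysics.PowerSystems
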